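import Mathlib.Analysis.SpecialFunctions.SmoothTransition
import Mathlib.Analysis.InnerProductSpace.Calculus
import Mathlib.Topology.MetricSpace.HausdorffDistance
import Mathlib.MeasureTheory.Covering.Vitali
import Mathlib.MeasureTheory.Measure.Lebesgue.EqHaar
import Mathlib.Analysis.InnerProductSpace.EuclideanDist
import HarnessLib

/-!
# Whitney's `C¹` extension theorem for compact sets (Evans–Gariepy, Thm. 6.10)

Topic `Literature/Analysis/Calculus`.  **Whitney's extension theorem, `C¹` case**: let
`E ⊂ X` be a compact subset of a finite-dimensional real inner product space, `f : E → F`,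
`d : E → L(X, F)` continuous with the uniform remainder condition
`sup {‖f y - f x - d x (y - x)‖ / ‖y - x‖ : x, y ∈ E, 0 < ‖x - y‖ ≤ δ} → 0` as `δ → 0`.
Then there is `f̄ : X → F` of class `C¹` with `f̄ = f` and `Df̄ = d` on `E`
[EvansGariepy2015, §6.5 Thm. 6.10] (there for closed `E ⊆ ℝⁿ`, `F = ℝ`, with the condition on
compact subsets; we treat compact `E`, which is what the `C¹`-triangulation theorem needs, and
Banach-space values).  The proof is the one printed in loc. cit. (after [Federer1969,
3.1.13–3.1.14]): a Vitali `5r`-subcover of the complement by balls of radius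
`r(x) = min(1, dist(x, E))/20`, the packing bound `#S_x ≤ 129ⁿ` (Claim 1), a smooth partition
of unity `v_j` with `‖Dv_j‖ ≤ C / r(x)`, the extension
`f̄ x = Σ_j v_j(x) (f(s_j) + d(s_j)(x - s_j))` with `s_j ∈ E` nearest to the centres, and the two
estimates (Claims 2, 3).  This file: Part 1 — radii, cutoffs and bumps with their derivative
bounds.

No named facts are introduced.

## References

* [EvansGariepy2015] L. C. Evans, R. F. Gariepy, *Measure Theory and Fine Properties of
  Functions*, revised ed., CRC Press 2015, §6.5, Theorem 6.10.
* [Federer1969] H. Federer, *Geometric Measure Theory*, Springer 1969, 3.1.13–3.1.14.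
* [Whitney1934] H. Whitney, *Analytic extensions of differentiable functions defined in closed
  sets*, Trans. AMS 36 (1934), Thm. I (case `m = 1`).

(The tree's `WhitneyExtension.lean` is the `C^∞` statement on closed convex bodies; this file is
the `C¹` statement on arbitrary compact sets, with proof.)
-/

open Set Filter Metric
open _root_.Topology

namespace Literature.Analysis.Calculus

namespace Whitney

section Rad

variable {X : Type*} [NormedAddCommGroup X]

/-! ## The radius function `r(x) = min(1, dist(x, E)) / 20` -/

/-- The Whitney radius `r(x) = min(1, dist(x, E)) / 20`. [cite: EvansGariepy2015, §6.5 Thm. 6.10, proof, step 1] -/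
noncomputable def rad (E : Set X) (x : X) : ℝ := min 1 (infDist x E) / 20

/-- `0 ≤ r`. [cite: EvansGariepy2015, §6.5 Thm. 6.10, step 1] -/
theorem rad_nonneg (E : Set X) (x : X) : 0 ≤ rad E x :=
  div_nonneg (le_min zero_le_one infDist_nonneg) (by norm_num)

/-- `r ≤ 1/20`. [cite: EvansGariepy2015, §6.5 Thm. 6.10, step 1] -/
theorem rad_le (E : Set X) (x : X) : rad E x ≤ 1 / 20 := by
  unfold rad
  have := min_le_left (1 : ℝ) (infDist x E)
  linarith

/-- `20 r ≤ dist(x, E)`. [cite: EvansGariepy2015, §6.5 Thm. 6.10, step 1] -/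
theorem twenty_mul_rad_le_infDist (E : Set X) (x : X) : 20 * rad E x ≤ infDist x E := by
  unfold rad
  have := min_le_right (1 : ℝ) (infDist x E)
  linarith

/-- Off a closed nonempty `E` the radius is positive. [cite: EvansGariepy2015, §6.5 Thm. 6.10, step 1] -/
theorem rad_pos {E : Set X} (hE : IsClosed E) (hne : E.Nonempty) {x : X} (hx : x ∉ E) : 0 < rad E x := by
  unfold rad
  have h : 0 < infDist x E := (infDist_pos_iff_notMem_closure hne).mp (by rwa [hE.closure_eq])
  have := lt_min zero_lt_one h
  positivity

/-- For points near `E` (`dist ≤ 1`), `20 r = dist(x, E)`. [cite: EvansGariepy2015, §6.5 Thm. 6.10, step 1] -/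
theorem twenty_mul_rad_eq {E : Set X} {x : X} (h : infDist x E ≤ 1) : 20 * rad E x = infDist x E := by
  unfold rad
  rw [min_eq_right h]
  ring

/-- **`r` is `1/20`-Lipschitz.** [cite: EvansGariepy2015, §6.5 Thm. 6.10, step 1] -/
theorem abs_rad_sub_rad_le (E : Set X) (x y : X) : |rad E x - rad E y| ≤ ‖x - y‖ / 20 := by
  unfold rad
  have h1 : |infDist x E - infDist y E| ≤ ‖x - y‖ := by
    have := lipschitz_infDist_pt (s := E) |>.dist_le_mul x y
    rw [NNReal.coe_one, one_mul, Real.dist_eq, dist_eq_norm] at this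
    exact this
  have h2 : |min 1 (infDist x E) - min 1 (infDist y E)| ≤ |infDist x E - infDist y E| :=
    abs_min_sub_min_le_max _ _ _ _ |>.trans (by simp)
  rw [← sub_div, abs_div, abs_of_pos (by norm_num : (0:ℝ) < 20)]
  exact div_le_div_of_nonneg_right (h2.trans h1) (by norm_num)

/-- **Comparable radii** (the second half of Claim 1): if `‖x - b‖ ≤ 10 (r x + r b)` then
`r x ≤ 3 r b` and `r b ≤ 3 r x`. [cite: EvansGariepy2015, §6.5 Thm. 6.10, Claim 1] -/
theorem rad_le_three_mul {E : Set X} {x b : X} (h : ‖x - b‖ ≤ 10 * (rad E x + rad E b)) :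
    rad E x ≤ 3 * rad E b ∧ rad E b ≤ 3 * rad E x := by
  have h1 := abs_rad_sub_rad_le E x b
  have h2 : |rad E x - rad E b| ≤ (rad E x + rad E b) / 2 := by
    calc |rad E x - rad E b| ≤ ‖x - b‖ / 20 := h1
      _ ≤ 10 * (rad E x + rad E b) / 20 := by gcongr
      _ = (rad E x + rad E b) / 2 := by ring
  rw [abs_le] at h2
  constructor <;> linarith [h2.1, h2.2]

end Rad

/-! ## The cutoff `μ` and the bumps `u_b` -/

section Cut

/-- The cutoff `μ`: smooth, `= 1` on `(-∞, 1]`, `= 0` on `[4, ∞)` (Evans–Gariepy's `μ` read on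
the square of the radius variable). [cite: EvansGariepy2015, §6.5 Thm. 6.10, step 3] -/
noncomputable def wcut (t : ℝ) : ℝ := Real.smoothTransition ((4 - t) / 3)

/-- `μ = 1` on `(-∞, 1]`. [cite: EvansGariepy2015, §6.5 Thm. 6.10, step 3] -/
theorem wcut_of_le_one {t : ℝ} (ht : t ≤ 1) : wcut t = 1 :=
  Real.smoothTransition.one_of_one_le (by rw [le_div_iff₀ (by norm_num : (0:ℝ) < 3)]; linarith)

/-- `μ = 0` on `[4, ∞)`. [cite: EvansGariepy2015, §6.5 Thm. 6.10, step 3] -/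
theorem wcut_of_four_le {t : ℝ} (ht : 4 ≤ t) : wcut t = 0 :=
  Real.smoothTransition.zero_of_nonpos (by rw [div_nonpos_iff]; right; constructor <;> linarith)

/-- `0 ≤ μ ≤ 1`. [cite: EvansGariepy2015, §6.5 Thm. 6.10, step 3] -/
theorem wcut_mem_Icc (t : ℝ) : wcut t ∈ Icc (0 : ℝ) 1 :=
  ⟨Real.smoothTransition.nonneg _, Real.smoothTransition.le_one _⟩

/-- `μ` is smooth. [cite: EvansGariepy2015, §6.5 Thm. 6.10, step 3] -/
theorem contDiff_wcut {n : ℕ∞} : ContDiff ℝ n wcut :=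
  Real.smoothTransition.contDiff.comp ((contDiff_const.sub contDiff_id).div_const 3)

/-- **`μ'` is bounded.** [cite: EvansGariepy2015, §6.5 Thm. 6.10, step 3] -/
theorem exists_bound_deriv_wcut : ∃ C : ℝ, 0 < C ∧ ∀ t, ‖deriv wcut t‖ ≤ C := by
  -- `deriv wcut` is continuous and vanishes off `[1, 4]`
  have hd : Continuous (deriv wcut) := (contDiff_wcut (n := 1)).continuous_deriv le_rfl
  have hzero : ∀ t, t ∉ Icc (1 : ℝ) 4 → deriv wcut t = 0 := by
    intro t ht
    rw [mem_Icc, not_and_or, not_le, not_le] at ht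
    rcases ht with ht | ht
    · -- locally constant `1`
      have hev : wcut =ᶠ[𝓝 t] fun _ => 1 :=
        (eventually_lt_nhds ht).mono fun s hs => wcut_of_le_one hs.le
      rw [hev.deriv_eq]
      exact deriv_const t 1
    · have hev : wcut =ᶠ[𝓝 t] fun _ => 0 :=
        (eventually_gt_nhds ht).mono fun s hs => wcut_of_four_le hs.le
      rw [hev.deriv_eq]
      exact deriv_const t 0
  obtain ⟨C, hC⟩ := isCompact_Icc.exists_bound_of_continuousOn (hd.norm.continuousOn (s := Icc (1:ℝ) 4))
  refine ⟨max C 1, by positivity, fun t => ?_⟩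
  by_cases ht : t ∈ Icc (1 : ℝ) 4
  · have := hC t ht
    rw [norm_norm] at this
    exact this.trans (le_max_left _ _)
  · rw [hzero t ht, norm_zero]
    positivity

end Cut

section Bump

variable {X : Type*} [NormedAddCommGroup X] [InnerProductSpace ℝ X]

/-- **The bump of centre `b` and radius `ρ`**: `u(y) = μ(‖y - b‖² / (25 ρ²))`, equal to `1` on
`B̄(b, 5ρ)` and to `0` off `B(b, 10ρ)` (Evans–Gariepy's `u_j = μ(|x - x_j| / 5 r_j)`, read
through the square to stay smooth). [cite: EvansGariepy2015, §6.5 Thm. 6.10, step 3] -/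
noncomputable def bump (b : X) (ρ : ℝ) (y : X) : ℝ := wcut (‖y - b‖ ^ 2 / (25 * ρ ^ 2))

omit [InnerProductSpace ℝ X] in
/-- `u = 1` on `B̄(b, 5ρ)`. [cite: EvansGariepy2015, §6.5 Thm. 6.10, step 3] -/
theorem bump_eq_one {b : X} {ρ : ℝ} (hρ : 0 < ρ) {y : X} (hy : ‖y - b‖ ≤ 5 * ρ) : bump b ρ y = 1 := by
  apply wcut_of_le_one
  rw [div_le_one (by positivity)]
  nlinarith [norm_nonneg (y - b)]

omit [InnerProductSpace ℝ X] in
/-- `u = 0` off `B(b, 10ρ)`. [cite: EvansGariepy2015, §6.5 Thm. 6.10, step 3] -/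
theorem bump_eq_zero {b : X} {ρ : ℝ} (hρ : 0 < ρ) {y : X} (hy : 10 * ρ ≤ ‖y - b‖) : bump b ρ y = 0 := by
  apply wcut_of_four_le
  rw [le_div_iff₀ (by positivity)]
  nlinarith

omit [InnerProductSpace ℝ X] in
/-- `0 ≤ u ≤ 1`. [cite: EvansGariepy2015, §6.5 Thm. 6.10, step 3] -/
theorem bump_mem_Icc (b : X) (ρ : ℝ) (y : X) : bump b ρ y ∈ Icc (0 : ℝ) 1 := wcut_mem_Icc _

/-- The bumps are smooth. [cite: EvansGariepy2015, §6.5 Thm. 6.10, step 3] -/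
theorem contDiff_bump (b : X) (ρ : ℝ) {n : ℕ∞} : ContDiff ℝ n (bump b ρ) := by
  unfold bump
  exact contDiff_wcut.comp (((contDiff_norm_sq ℝ).comp (contDiff_id.sub contDiff_const)).div_const _)

/-- The derivative of a bump. [cite: EvansGariepy2015, §6.5 Thm. 6.10, step 3] -/
theorem hasFDerivAt_bump (b : X) (ρ : ℝ) (y : X) :
    HasFDerivAt (bump b ρ) (deriv wcut (‖y - b‖ ^ 2 / (25 * ρ ^ 2)) •
      ((25 * ρ ^ 2)⁻¹ • ((2 : ℝ) • innerSL ℝ (y - b)))) y := by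
  have h1 : HasFDerivAt (fun y : X => ‖y - b‖ ^ 2) ((2 : ℝ) • innerSL ℝ (y - b)) y := by
    have h := ((hasFDerivAt_id y).sub_const b).norm_sq
    have heq : (2 • (innerSL ℝ (id y - b)).comp (ContinuousLinearMap.id ℝ X) : X →L[ℝ] ℝ) =
        (2 : ℝ) • innerSL ℝ (y - b) := by
      rw [ContinuousLinearMap.comp_id, ← Nat.cast_smul_eq_nsmul ℝ]
      norm_num
    rw [heq] at h
    exact h
  have h2 : HasFDerivAt (fun y : X => ‖y - b‖ ^ 2 / (25 * ρ ^ 2))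
      ((25 * ρ ^ 2)⁻¹ • ((2 : ℝ) • innerSL ℝ (y - b))) y := by
    have := h1.const_smul (25 * ρ ^ 2)⁻¹
    refine this.congr_of_eventuallyEq (Eventually.of_forall fun z => ?_)
    simp only [Pi.smul_apply, smul_eq_mul]
    rw [div_eq_inv_mul]
  have h3 : HasDerivAt wcut (deriv wcut (‖y - b‖ ^ 2 / (25 * ρ ^ 2))) (‖y - b‖ ^ 2 / (25 * ρ ^ 2)) :=
    ((contDiff_wcut (n := 1)).differentiable (by simp)).differentiableAt.hasDerivAt
  exact h3.comp_hasFDerivAt y h2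

/-- **The derivative bound for the bumps**: `‖Du(y)‖ ≤ C_μ / ρ` (`C_μ` a bound for `μ'`; on the
support `‖y - b‖ ≤ 10ρ`, off it `Du = 0`). [cite: EvansGariepy2015, §6.5 Thm. 6.10, (⋆⋆)] -/
theorem norm_fderiv_bump_le {C : ℝ} (hC : ∀ t, ‖deriv wcut t‖ ≤ C) {b : X} {ρ : ℝ} (hρ : 0 < ρ) (y : X) :
    ‖fderiv ℝ (bump b ρ) y‖ ≤ C / ρ := by
  have hC0 : 0 ≤ C := (norm_nonneg _).trans (hC 0)
  by_cases hy : ‖y - b‖ ≤ 10 * ρ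
  · rw [(hasFDerivAt_bump b ρ y).fderiv, norm_smul, norm_smul, norm_smul]
    have h1 : ‖innerSL ℝ (y - b)‖ = ‖y - b‖ := innerSL_apply_norm ℝ (y - b)
    have h2 : ‖(2 : ℝ)‖ = 2 := by norm_num
    have h25 : ‖(25 * ρ ^ 2)⁻¹‖ = (25 * ρ ^ 2)⁻¹ := by
      rw [norm_inv, Real.norm_of_nonneg (by positivity)]
    rw [h1, h2, h25]
    calc ‖deriv wcut (‖y - b‖ ^ 2 / (25 * ρ ^ 2))‖ * ((25 * ρ ^ 2)⁻¹ * (2 * ‖y - b‖))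
        ≤ C * ((25 * ρ ^ 2)⁻¹ * (2 * (10 * ρ))) := by gcongr; exact hC _
      _ = (4 * C / 5) / ρ := by field_simp; ring
      _ ≤ C / ρ := by rw [div_le_div_iff_of_pos_right hρ]; linarith
  · -- locally zero
    push Not at hy
    have hev : bump b ρ =ᶠ[𝓝 y] fun _ => 0 := by
      have hopen : IsOpen {z : X | 10 * ρ < ‖z - b‖} := isOpen_lt continuous_const (continuous_id.sub continuous_const).norm
      exact Filter.eventuallyEq_of_mem (hopen.mem_nhds hy) fun z hz => bump_eq_zero hρ (le_of_lt hz)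
    rw [hev.fderiv_eq, fderiv_const_apply, norm_zero]
    positivity

end Bump

/-! ## Packing: disjoint balls of radius `ρ` in a ball of radius `R` -/

section Packing

open MeasureTheory Module

variable {X : Type*} [NormedAddCommGroup X] [NormedSpace ℝ X] [FiniteDimensional ℝ X]

/-- **Volume packing bound**: `#S · ρⁿ ≤ Rⁿ` for a finite set `S` of centres of pairwise disjoint
balls of radius `ρ` inside a ball of radius `R`. [cite: EvansGariepy2015, §6.5 Thm. 6.10, Claim 1] -/
theorem card_mul_pow_le_of_disjoint_balls (S : Finset X) (x : X) {ρ R : ℝ} (hρ : 0 < ρ) (hR : 0 < R)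
    (hdisj : (S : Set X).PairwiseDisjoint fun b => ball b ρ) (hsub : ∀ b ∈ S, ball b ρ ⊆ ball x R) :
    (S.card : ℝ) * ρ ^ finrank ℝ X ≤ R ^ finrank ℝ X := by
  classical
  borelize X
  let μ : Measure X := Measure.addHaar
  have hmeas : ∀ b ∈ S, MeasurableSet (ball b ρ) := fun b _ => measurableSet_ball
  have h1 : μ (⋃ b ∈ S, ball b ρ) = ∑ b ∈ S, μ (ball b ρ) := measure_biUnion_finset hdisj hmeas
  have h2 : μ (⋃ b ∈ S, ball b ρ) ≤ μ (ball x R) := measure_mono (iUnion₂_subset hsub)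
  have hball : ∀ b : X, ∀ r : ℝ, 0 < r → μ (ball b r) = ENNReal.ofReal (r ^ finrank ℝ X) * μ (ball 0 1) :=
    fun b r hr => Measure.addHaar_ball_of_pos μ b hr
  rw [h1, Finset.sum_congr rfl (fun b _ => hball b ρ hρ), Finset.sum_const, hball x R hR, nsmul_eq_mul] at h2
  have h0 : μ (ball (0:X) 1) ≠ 0 := (measure_ball_pos μ 0 one_pos).ne'
  have htop : μ (ball (0:X) 1) ≠ ⊤ := measure_ball_lt_top.ne
  have h3 : (S.card : ENNReal) * ENNReal.ofReal (ρ ^ finrank ℝ X) ≤ ENNReal.ofReal (R ^ finrank ℝ X) := by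
    rw [← mul_assoc] at h2
    exact (ENNReal.mul_le_mul_iff_left h0 htop).mp h2
  have h4 : ENNReal.ofReal ((S.card : ℝ) * ρ ^ finrank ℝ X) ≤ ENNReal.ofReal (R ^ finrank ℝ X) := by
    rwa [ENNReal.ofReal_mul (Nat.cast_nonneg _), ENNReal.ofReal_natCast]
  exact (ENNReal.ofReal_le_ofReal_iff (by positivity)).mp h4

end Packing

/-! ## The Vitali cover of the complement and the finite sets `S_x` -/

section Cover

open Module

variable {X : Type*} [NormedAddCommGroup X]

/-- **A Whitney cover** of the complement of `E`: a set `u ⊆ Eᶜ` of centres whose balls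
`B(b, r b)` are pairwise disjoint and whose triples `B(b, 3 r b)` cover `Eᶜ` (Vitali).
[cite: EvansGariepy2015, §6.5 Thm. 6.10, step 1] -/
structure Cover (E : Set X) where
  /-- the centres -/
  u : Set X
  /-- the centres lie off `E` -/
  u_subset : u ⊆ Eᶜ
  /-- the small balls are pairwise disjoint -/
  disjoint : u.PairwiseDisjoint fun b => ball b (rad E b)
  /-- the triple balls cover the complement -/
  cover : ∀ a ∈ Eᶜ, ∃ b ∈ u, ‖a - b‖ < 3 * rad E b

/-- **Existence of a Whitney cover** (Vitali's covering theorem). [cite: EvansGariepy2015, §6.5 Thm. 6.10, step 1] -/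
theorem exists_cover {E : Set X} (hE : IsClosed E) (hne : E.Nonempty) : Nonempty (Cover E) := by
  obtain ⟨u, hut, hdisj, hcov⟩ := Vitali.exists_disjoint_subfamily_covering_enlargement
    (fun a : X => ball a (rad E a)) Eᶜ (rad E) 2 one_lt_two (fun a _ => rad_nonneg E a) (1 / 20)
    (fun a _ => rad_le E a) (fun a ha => ⟨a, mem_ball_self (rad_pos hE hne ha)⟩)
  refine ⟨⟨u, hut, hdisj, fun a ha => ?_⟩⟩
  obtain ⟨b, hb, ⟨z, hza, hzb⟩, hle⟩ := hcov a ha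
  refine ⟨b, hb, ?_⟩
  rw [mem_ball, dist_eq_norm] at hza hzb
  calc ‖a - b‖ = ‖(z - b) - (z - a)‖ := by congr 1; abel
    _ ≤ ‖z - b‖ + ‖z - a‖ := norm_sub_le _ _
    _ < rad E b + rad E a := add_lt_add hzb hza
    _ ≤ 3 * rad E b := by linarith

variable {E : Set X}

/-- The centres near `x`: `S_x = {b ∈ u : B(x, 10 r x) ∩ B(b, 10 r b) ≠ ∅}`.
[cite: EvansGariepy2015, §6.5 Thm. 6.10, step 1] -/
def Cover.near (c : Cover E) (x : X) : Set X := {b ∈ c.u | ‖x - b‖ < 10 * (rad E x + rad E b)}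

/-- Membership in `S_x`. [cite: EvansGariepy2015, §6.5 Thm. 6.10, step 1] -/
theorem Cover.mem_near_iff (c : Cover E) {x b : X} : b ∈ c.near x ↔ b ∈ c.u ∧ ‖x - b‖ < 10 * (rad E x + rad E b) :=
  Iff.rfl

/-- **Comparable radii on `S_x`** (Claim 1, second part). [cite: EvansGariepy2015, §6.5 Thm. 6.10, Claim 1] -/
theorem Cover.rad_le_of_mem_near (c : Cover E) {x b : X} (hb : b ∈ c.near x) :
    rad E x ≤ 3 * rad E b ∧ rad E b ≤ 3 * rad E x :=
  rad_le_three_mul hb.2.le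

/-- Off `S_x` the bumps vanish on `B(x, 10 r x)`. [cite: EvansGariepy2015, §6.5 Thm. 6.10, step 3] -/
theorem Cover.bump_eq_zero_of_not_mem_near (c : Cover E) (hE : IsClosed E) (hne : E.Nonempty) {x b y : X}
    (hb : b ∈ c.u) (hbn : b ∉ c.near x) (hy : ‖y - x‖ < 10 * rad E x) : bump b (rad E b) y = 0 := by
  have hrb : 0 < rad E b := rad_pos hE hne (c.u_subset hb)
  apply bump_eq_zero hrb
  by_contra h
  push Not at h
  apply hbn
  refine ⟨hb, ?_⟩
  calc ‖x - b‖ = ‖(y - b) - (y - x)‖ := by congr 1; abel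
    _ ≤ ‖y - b‖ + ‖y - x‖ := norm_sub_le _ _
    _ < 10 * rad E b + 10 * rad E x := add_lt_add h hy
    _ = 10 * (rad E x + rad E b) := by ring

variable [NormedSpace ℝ X] [FiniteDimensional ℝ X]

/-- **Claim 1: `S_x` is finite with at most `129ⁿ` elements.**
[cite: EvansGariepy2015, §6.5 Thm. 6.10, Claim 1] -/
theorem Cover.near_finite (c : Cover E) {x : X} (hx : 0 < rad E x) :
    (c.near x).Finite ∧ ∀ S : Finset X, ↑S ⊆ c.near x → (S.card : ℝ) ≤ 129 ^ finrank ℝ X := by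
  classical
  -- the finite-subset bound
  have hbound : ∀ S : Finset X, ↑S ⊆ c.near x → (S.card : ℝ) ≤ 129 ^ finrank ℝ X := by
    intro S hS
    have hρ : 0 < rad E x / 3 := by positivity
    have hdisj : (S : Set X).PairwiseDisjoint fun b => ball b (rad E x / 3) := by
      intro b hb b' hb' hne
      have h := c.disjoint (hS hb).1 (hS hb').1 hne
      refine Set.disjoint_of_subset (ball_subset_ball ?_) (ball_subset_ball ?_) h
      · linarith [(c.rad_le_of_mem_near (hS hb)).1]
      · linarith [(c.rad_le_of_mem_near (hS hb')).1]
    have hsub : ∀ b ∈ S, ball b (rad E x / 3) ⊆ ball x (43 * rad E x) := by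
      intro b hb y hy
      rw [mem_ball, dist_eq_norm] at hy ⊢
      have h1 := (hS hb).2
      have h2 := (c.rad_le_of_mem_near (hS hb)).2
      calc ‖y - x‖ = ‖(y - b) - (x - b)‖ := by congr 1; abel
        _ ≤ ‖y - b‖ + ‖x - b‖ := norm_sub_le _ _
        _ < rad E x / 3 + 10 * (rad E x + rad E b) := add_lt_add_of_lt_of_le hy h1.le
        _ ≤ 43 * rad E x := by linarith
    have h := card_mul_pow_le_of_disjoint_balls S x hρ (by positivity) hdisj hsub
    have hpow : (43 * rad E x) ^ finrank ℝ X = 129 ^ finrank ℝ X * (rad E x / 3) ^ finrank ℝ X := by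
      rw [← mul_pow]; congr 1; ring
    rw [hpow] at h
    exact le_of_mul_le_mul_right h (pow_pos hρ _)
  refine ⟨?_, hbound⟩
  by_contra hinf
  obtain ⟨S, hS, hcard⟩ := Set.Infinite.exists_subset_card_eq hinf (129 ^ finrank ℝ X + 1)
  have h := hbound S hS
  rw [hcard] at h
  push_cast at h
  linarith

/-- `S_x` as a finset. [cite: EvansGariepy2015, §6.5 Thm. 6.10, Claim 1] -/
noncomputable def Cover.nearF (c : Cover E) (x : X) (hx : 0 < rad E x) : Finset X := (c.near_finite hx).1.toFinset

/-- Membership in the finset `S_x`. [cite: EvansGariepy2015, §6.5 Thm. 6.10, Claim 1] -/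
theorem Cover.mem_nearF_iff (c : Cover E) {x : X} (hx : 0 < rad E x) {b : X} : b ∈ c.nearF x hx ↔ b ∈ c.near x :=
  Set.Finite.mem_toFinset _

/-- **Claim 1**: `#S_x ≤ 129ⁿ`. [cite: EvansGariepy2015, §6.5 Thm. 6.10, Claim 1] -/
theorem Cover.card_nearF_le (c : Cover E) {x : X} (hx : 0 < rad E x) :
    ((c.nearF x hx).card : ℝ) ≤ 129 ^ finrank ℝ X :=
  (c.near_finite hx).2 _ (by intro b hb; exact (c.mem_nearF_iff hx).mp hb)

end Cover

/-! ## The partition of unity `v_b = u_b / σ` -/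

section Partition

open Module

variable {X : Type*} [NormedAddCommGroup X] [InnerProductSpace ℝ X] [FiniteDimensional ℝ X]
  {E : Set X}

/-- The bump attached to a centre (`0` for non-centres). [cite: EvansGariepy2015, §6.5 Thm. 6.10, step 3] -/
noncomputable def Cover.w (c : Cover E) (b : X) (y : X) : ℝ := by
  classical exact if b ∈ c.u then bump b (rad E b) y else 0

/-- `σ = Σ_j u_j`. [cite: EvansGariepy2015, §6.5 Thm. 6.10, step 3] -/
noncomputable def Cover.sigma (c : Cover E) (y : X) : ℝ := ∑ᶠ b, c.w b y

/-- On `B(x, 10 r x)` only the centres of `S_x` contribute. [cite: EvansGariepy2015, §6.5 Thm. 6.10, step 3] -/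
theorem Cover.support_w_subset (c : Cover E) (hE : IsClosed E) (hne : E.Nonempty) {x : X} (hx : 0 < rad E x)
    {y : X} (hy : ‖y - x‖ < 10 * rad E x) : (Function.support fun b => c.w b y) ⊆ ↑(c.nearF x hx) := by
  classical
  intro b hb
  rw [Function.mem_support] at hb
  rw [Finset.mem_coe, c.mem_nearF_iff hx]
  unfold Cover.w at hb
  split_ifs at hb with hbu
  · by_contra hbn
    exact hb (c.bump_eq_zero_of_not_mem_near hE hne hbu hbn hy)
  · exact absurd rfl hb

/-- **Local representation of `σ`** as a finite sum on `B(x, 10 r x)`.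
[cite: EvansGariepy2015, §6.5 Thm. 6.10, step 3] -/
theorem Cover.sigma_eq_sum (c : Cover E) (hE : IsClosed E) (hne : E.Nonempty) {x : X} (hx : 0 < rad E x)
    {y : X} (hy : ‖y - x‖ < 10 * rad E x) : c.sigma y = ∑ b ∈ c.nearF x hx, bump b (rad E b) y := by
  classical
  rw [Cover.sigma, finsum_eq_sum_of_support_subset _ (c.support_w_subset hE hne hx hy)]
  refine Finset.sum_congr rfl fun b hb => ?_
  rw [c.mem_nearF_iff hx] at hb
  simp [Cover.w, hb.1]

/-- **`σ ≥ 1` on the complement.** [cite: EvansGariepy2015, §6.5 Thm. 6.10, step 3] -/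
theorem Cover.one_le_sigma (c : Cover E) (hE : IsClosed E) (hne : E.Nonempty) {y : X} (hy : y ∉ E) :
    1 ≤ c.sigma y := by
  classical
  have hry : 0 < rad E y := rad_pos hE hne hy
  rw [c.sigma_eq_sum hE hne hry (by simp [hry] : ‖y - y‖ < 10 * rad E y)]
  obtain ⟨b, hb, hyb⟩ := c.cover y hy
  have hrb : 0 < rad E b := rad_pos hE hne (c.u_subset hb)
  have hbn : b ∈ c.nearF y hry := by
    rw [c.mem_nearF_iff hry]
    exact ⟨hb, by linarith⟩
  have h1 : bump b (rad E b) y = 1 := bump_eq_one hrb (by linarith)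
  calc (1 : ℝ) = bump b (rad E b) y := h1.symm
    _ ≤ ∑ b' ∈ c.nearF y hry, bump b' (rad E b') y :=
        Finset.single_le_sum (fun b' _ => (bump_mem_Icc b' _ y).1) hbn

/-- **`σ` is smooth on the complement** (locally a finite sum of bumps).
[cite: EvansGariepy2015, §6.5 Thm. 6.10, step 3] -/
theorem Cover.contDiffAt_sigma (c : Cover E) (hE : IsClosed E) (hne : E.Nonempty) {x : X} (hx : x ∉ E) {n : ℕ∞} :
    ContDiffAt ℝ n c.sigma x := by
  have hrx : 0 < rad E x := rad_pos hE hne hx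
  have hev : c.sigma =ᶠ[𝓝 x] fun y => ∑ b ∈ c.nearF x hrx, bump b (rad E b) y := by
    have hopen : IsOpen {y : X | ‖y - x‖ < 10 * rad E x} :=
      isOpen_lt (continuous_id.sub continuous_const).norm continuous_const
    exact Filter.eventuallyEq_of_mem (hopen.mem_nhds (by simp [hrx])) fun y hy => c.sigma_eq_sum hE hne hrx hy
  refine ContDiffAt.congr_of_eventuallyEq ?_ hev
  exact (ContDiff.sum fun b _ => contDiff_bump b (rad E b)).contDiffAt

/-- The derivative of `σ`. [cite: EvansGariepy2015, §6.5 Thm. 6.10, step 3] -/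
theorem Cover.hasFDerivAt_sigma (c : Cover E) (hE : IsClosed E) (hne : E.Nonempty) {x : X} (hx : x ∉ E) :
    HasFDerivAt c.sigma (∑ b ∈ c.nearF x (rad_pos hE hne hx), fderiv ℝ (bump b (rad E b)) x) x := by
  have hrx : 0 < rad E x := rad_pos hE hne hx
  have hev : c.sigma =ᶠ[𝓝 x] fun y => ∑ b ∈ c.nearF x hrx, bump b (rad E b) y := by
    have hopen : IsOpen {y : X | ‖y - x‖ < 10 * rad E x} :=
      isOpen_lt (continuous_id.sub continuous_const).norm continuous_const
    exact Filter.eventuallyEq_of_mem (hopen.mem_nhds (by simp [hrx])) fun y hy => c.sigma_eq_sum hE hne hrx hy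
  refine HasFDerivAt.congr_of_eventuallyEq ?_ hev
  exact HasFDerivAt.fun_sum fun b _ => (hasFDerivAt_bump b (rad E b) x).differentiableAt.hasFDerivAt

/-- **The derivative bound for `σ`**: `‖Dσ(x)‖ ≤ 3 · 129ⁿ C_μ / r(x)`.
[cite: EvansGariepy2015, §6.5 Thm. 6.10, step 3] -/
theorem Cover.norm_fderiv_sigma_le (c : Cover E) (hE : IsClosed E) (hne : E.Nonempty) {C : ℝ}
    (hC : ∀ t, ‖deriv wcut t‖ ≤ C) {x : X} (hx : x ∉ E) :
    ‖fderiv ℝ c.sigma x‖ ≤ 3 * 129 ^ finrank ℝ X * C / rad E x := by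
  have hrx : 0 < rad E x := rad_pos hE hne hx
  have hC0 : 0 ≤ C := (norm_nonneg _).trans (hC 0)
  rw [(c.hasFDerivAt_sigma hE hne hx).fderiv]
  have hterm : ∀ b ∈ c.nearF x hrx, ‖fderiv ℝ (bump b (rad E b)) x‖ ≤ 3 * C / rad E x := by
    intro b hb
    rw [c.mem_nearF_iff hrx] at hb
    have hrb : 0 < rad E b := rad_pos hE hne (c.u_subset hb.1)
    have h3 := (c.rad_le_of_mem_near hb).1
    calc ‖fderiv ℝ (bump b (rad E b)) x‖ ≤ C / rad E b := norm_fderiv_bump_le hC hrb x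
      _ ≤ C / (rad E x / 3) := div_le_div_of_nonneg_left hC0 (by positivity) (by linarith)
      _ = 3 * C / rad E x := by field_simp
  calc ‖∑ b ∈ c.nearF x hrx, fderiv ℝ (bump b (rad E b)) x‖
      ≤ ∑ b ∈ c.nearF x hrx, ‖fderiv ℝ (bump b (rad E b)) x‖ := norm_sum_le _ _
    _ ≤ ∑ _b ∈ c.nearF x hrx, 3 * C / rad E x := Finset.sum_le_sum hterm
    _ = (c.nearF x hrx).card * (3 * C / rad E x) := by rw [Finset.sum_const, nsmul_eq_mul]
    _ ≤ 129 ^ finrank ℝ X * (3 * C / rad E x) :=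
        mul_le_mul_of_nonneg_right (c.card_nearF_le hrx) (by positivity)
    _ = 3 * 129 ^ finrank ℝ X * C / rad E x := by ring

/-- The partition functions `v_b = u_b / σ`. [cite: EvansGariepy2015, §6.5 Thm. 6.10, step 3] -/
noncomputable def Cover.v (c : Cover E) (b : X) (y : X) : ℝ := c.w b y / c.sigma y

omit [InnerProductSpace ℝ X] [FiniteDimensional ℝ X] in
/-- `v_b = u_b / σ` for centres. [cite: EvansGariepy2015, §6.5 Thm. 6.10, step 3] -/
theorem Cover.v_eq (c : Cover E) {b : X} (hb : b ∈ c.u) (y : X) : c.v b y = bump b (rad E b) y / c.sigma y := by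
  classical
  simp [Cover.v, Cover.w, hb]

/-- `0 ≤ v_b ≤ 1` on the complement. [cite: EvansGariepy2015, §6.5 Thm. 6.10, step 3] -/
theorem Cover.v_mem_Icc (c : Cover E) (hE : IsClosed E) (hne : E.Nonempty) (b : X) {y : X} (hy : y ∉ E) :
    c.v b y ∈ Icc (0 : ℝ) 1 := by
  classical
  have hσ := c.one_le_sigma hE hne hy
  unfold Cover.v Cover.w
  split_ifs with hb
  · refine ⟨div_nonneg (bump_mem_Icc b _ y).1 (by linarith), ?_⟩
    rw [div_le_one (by linarith)]
    exact (bump_mem_Icc b _ y).2.trans hσ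
  · simp

/-- **`Σ_b v_b = 1` on the complement** (as a finite sum over `S_x`).
[cite: EvansGariepy2015, §6.5 Thm. 6.10, step 3] -/
theorem Cover.sum_v_eq_one (c : Cover E) (hE : IsClosed E) (hne : E.Nonempty) {x : X} (hx : x ∉ E)
    {y : X} (hy : ‖y - x‖ < 10 * rad E x) (hyE : y ∉ E) :
    ∑ b ∈ c.nearF x (rad_pos hE hne hx), c.v b y = 1 := by
  have hrx : 0 < rad E x := rad_pos hE hne hx
  have hσ := c.one_le_sigma hE hne hyE
  have h : ∑ b ∈ c.nearF x hrx, c.v b y = (∑ b ∈ c.nearF x hrx, bump b (rad E b) y) / c.sigma y := by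
    rw [Finset.sum_div]
    refine Finset.sum_congr rfl fun b hb => ?_
    rw [c.mem_nearF_iff hrx] at hb
    exact c.v_eq hb.1 y
  rw [h, ← c.sigma_eq_sum hE hne hrx hy, div_self (by linarith)]


/-- The derivative of `v_b` at a point of the complement (a name for the formula).
[cite: EvansGariepy2015, §6.5 Thm. 6.10, step 3] -/
noncomputable def Cover.Dv (c : Cover E) (b x : X) : X →L[ℝ] ℝ :=
  bump b (rad E b) x • (-(c.sigma x ^ 2)⁻¹ • fderiv ℝ c.sigma x) + (c.sigma x)⁻¹ • fderiv ℝ (bump b (rad E b)) x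

/-- **`v_b` is differentiable on the complement** with derivative `Dv`. [cite: EvansGariepy2015, §6.5 Thm. 6.10, step 3] -/
theorem Cover.hasFDerivAt_v (c : Cover E) (hE : IsClosed E) (hne : E.Nonempty) {b : X} (hb : b ∈ c.u)
    {x : X} (hx : x ∉ E) : HasFDerivAt (c.v b) (c.Dv b x) x := by
  have hσ : c.sigma x ≠ 0 := by linarith [c.one_le_sigma hE hne hx]
  have hfun : c.v b = fun y => bump b (rad E b) y * (c.sigma y)⁻¹ := by
    funext y; rw [c.v_eq hb, div_eq_mul_inv]
  rw [hfun]
  have h1 := hasFDerivAt_bump b (rad E b) x |>.differentiableAt.hasFDerivAt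
  have h2 : HasFDerivAt (fun y => (c.sigma y)⁻¹) ((-(c.sigma x ^ 2)⁻¹) • fderiv ℝ c.sigma x) x :=
    (hasDerivAt_inv hσ).comp_hasFDerivAt x (c.hasFDerivAt_sigma hE hne hx).differentiableAt.hasFDerivAt
  exact h1.mul h2

/-- **The derivative bound for `v_b`**: `‖Dv_b(x)‖ ≤ C₃ / r(x)` with
`C₃ = 3 C_μ (1 + 129ⁿ)`. [cite: EvansGariepy2015, §6.5 Thm. 6.10, step 3] -/
theorem Cover.norm_Dv_le (c : Cover E) (hE : IsClosed E) (hne : E.Nonempty) {C : ℝ}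
    (hC : ∀ t, ‖deriv wcut t‖ ≤ C) {x : X} (hx : x ∉ E) {b : X} (hb : b ∈ c.near x) :
    ‖c.Dv b x‖ ≤ 3 * C * (1 + 129 ^ finrank ℝ X) / rad E x := by
  have hrx : 0 < rad E x := rad_pos hE hne hx
  have hC0 : 0 ≤ C := (norm_nonneg _).trans (hC 0)
  have hσ1 := c.one_le_sigma hE hne hx
  have hrb : 0 < rad E b := rad_pos hE hne (c.u_subset hb.1)
  have hbump := bump_mem_Icc b (rad E b) x
  have h1 : ‖fderiv ℝ (bump b (rad E b)) x‖ ≤ 3 * C / rad E x := by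
    calc ‖fderiv ℝ (bump b (rad E b)) x‖ ≤ C / rad E b := norm_fderiv_bump_le hC hrb x
      _ ≤ C / (rad E x / 3) := div_le_div_of_nonneg_left hC0 (by positivity) (by linarith [(c.rad_le_of_mem_near hb).1])
      _ = 3 * C / rad E x := by field_simp
  have h2 := c.norm_fderiv_sigma_le hE hne hC hx
  unfold Cover.Dv
  calc ‖bump b (rad E b) x • (-(c.sigma x ^ 2)⁻¹ • fderiv ℝ c.sigma x) + (c.sigma x)⁻¹ • fderiv ℝ (bump b (rad E b)) x‖
      ≤ ‖bump b (rad E b) x • (-(c.sigma x ^ 2)⁻¹ • fderiv ℝ c.sigma x)‖ + ‖(c.sigma x)⁻¹ • fderiv ℝ (bump b (rad E b)) x‖ :=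
        norm_add_le _ _
    _ ≤ ‖fderiv ℝ c.sigma x‖ + ‖fderiv ℝ (bump b (rad E b)) x‖ := by
        gcongr
        · rw [norm_smul, norm_smul, norm_neg, norm_inv, norm_pow, Real.norm_of_nonneg hbump.1,
            Real.norm_of_nonneg (by linarith)]
          have : bump b (rad E b) x * ((c.sigma x ^ 2)⁻¹ * ‖fderiv ℝ c.sigma x‖) ≤ 1 * (1 * ‖fderiv ℝ c.sigma x‖) := by
            gcongr
            · exact hbump.2
            · rw [inv_le_one_iff₀]; right; nlinarith
          linarith
        · rw [norm_smul, norm_inv, Real.norm_of_nonneg (by linarith)]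
          have : (c.sigma x)⁻¹ * ‖fderiv ℝ (bump b (rad E b)) x‖ ≤ 1 * ‖fderiv ℝ (bump b (rad E b)) x‖ := by
            gcongr; rw [inv_le_one_iff₀]; right; exact hσ1
          linarith
    _ ≤ 3 * 129 ^ finrank ℝ X * C / rad E x + 3 * C / rad E x := add_le_add h2 h1
    _ = 3 * C * (1 + 129 ^ finrank ℝ X) / rad E x := by field_simp; ring

/-- **`Σ_b Dv_b = 0`** on the complement. [cite: EvansGariepy2015, §6.5 Thm. 6.10, step 3] -/
theorem Cover.sum_Dv_eq_zero (c : Cover E) (hE : IsClosed E) (hne : E.Nonempty) {x : X} (hx : x ∉ E) :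
    ∑ b ∈ c.nearF x (rad_pos hE hne hx), c.Dv b x = 0 := by
  have hrx : 0 < rad E x := rad_pos hE hne hx
  -- the finite sum of the `v_b` is `1` near `x`
  have hev : (fun y => ∑ b ∈ c.nearF x hrx, c.v b y) =ᶠ[𝓝 x] fun _ => (1 : ℝ) := by
    have hopen : IsOpen ({y : X | ‖y - x‖ < 10 * rad E x} ∩ Eᶜ) :=
      (isOpen_lt (continuous_id.sub continuous_const).norm continuous_const).inter hE.isOpen_compl
    refine Filter.eventuallyEq_of_mem (hopen.mem_nhds ⟨by simp [hrx], hx⟩) fun y hy => ?_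
    exact c.sum_v_eq_one hE hne hx hy.1 hy.2
  have h1 : HasFDerivAt (fun y => ∑ b ∈ c.nearF x hrx, c.v b y) (∑ b ∈ c.nearF x hrx, c.Dv b x) x :=
    HasFDerivAt.fun_sum fun b hb => c.hasFDerivAt_v hE hne ((c.mem_nearF_iff hrx).mp hb).1 hx
  have h2 : HasFDerivAt (fun y => ∑ b ∈ c.nearF x hrx, c.v b y) (0 : X →L[ℝ] ℝ) x :=
    (hasFDerivAt_const (1 : ℝ) x).congr_of_eventuallyEq hev
  exact h1.unique h2

end Partition

/-! ## The extension `f̄` -/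

section Extension

open Module

variable {X : Type*} [NormedAddCommGroup X] [InnerProductSpace ℝ X] [FiniteDimensional ℝ X]
  {E : Set X} {F : Type*} [NormedAddCommGroup F] [NormedSpace ℝ F]

/-- A nearest point of `E` (compact, nonempty). [cite: EvansGariepy2015, §6.5 Thm. 6.10, step 4] -/
noncomputable def npt (hE : IsCompact E) (hne : E.Nonempty) (b : X) : X :=
  Classical.choose (hE.exists_infDist_eq_dist hne b)

omit [InnerProductSpace ℝ X] [FiniteDimensional ℝ X] in
/-- The nearest point lies in `E` and realises the distance. [cite: EvansGariepy2015, §6.5 Thm. 6.10, step 4] -/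
theorem npt_spec (hE : IsCompact E) (hne : E.Nonempty) (b : X) :
    npt hE hne b ∈ E ∧ infDist b E = dist b (npt hE hne b) :=
  Classical.choose_spec (hE.exists_infDist_eq_dist hne b)

/-- The affine germs `A_b(y) = f(s_b) + d(s_b)(y - s_b)`. [cite: EvansGariepy2015, §6.5 Thm. 6.10, step 4] -/
def germ (f : X → F) (d : X → X →L[ℝ] F) (s : X) (y : X) : F := f s + d s (y - s)

/-- **Whitney's extension** `f̄`: `f` on `E`, `Σ_b v_b(y) A_b(y)` off `E`.
[cite: EvansGariepy2015, §6.5 Thm. 6.10, step 4] -/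
noncomputable def Cover.ext (c : Cover E) (hE : IsCompact E) (hne : E.Nonempty) (f : X → F) (d : X → X →L[ℝ] F)
    (y : X) : F := by
  classical
  exact if y ∈ E then f y else ∑ᶠ b, c.v b y • germ f d (npt hE hne b) y

omit [FiniteDimensional ℝ X] in
/-- `f̄ = f` on `E`. [cite: EvansGariepy2015, §6.5 Thm. 6.10 (ii)] -/
theorem Cover.ext_of_mem (c : Cover E) (hE : IsCompact E) (hne : E.Nonempty) (f : X → F) (d : X → X →L[ℝ] F)
    {y : X} (hy : y ∈ E) : c.ext hE hne f d y = f y := by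
  classical
  simp [Cover.ext, hy]

/-- **Local representation of `f̄` off `E`** as a finite sum over `S_x`.
[cite: EvansGariepy2015, §6.5 Thm. 6.10, step 4] -/
theorem Cover.ext_eq_sum (c : Cover E) (hE : IsCompact E) (hne : E.Nonempty) (f : X → F) (d : X → X →L[ℝ] F)
    {x : X} (hx : 0 < rad E x) {y : X} (hy : ‖y - x‖ < 10 * rad E x) (hyE : y ∉ E) :
    c.ext hE hne f d y = ∑ b ∈ c.nearF x hx, c.v b y • germ f d (npt hE hne b) y := by
  classical
  simp only [Cover.ext, hyE, if_false]
  apply finsum_eq_sum_of_support_subset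
  intro b hb
  rw [Function.mem_support] at hb
  have hw : c.w b y ≠ 0 := by
    intro h
    apply hb
    rw [Cover.v, h, zero_div, zero_smul]
  exact c.support_w_subset hE.isClosed hne hx hy (Function.mem_support.mpr hw)

/-- **`f̄` is smooth off `E`.** [cite: EvansGariepy2015, §6.5 Thm. 6.10, step 4] -/
theorem Cover.contDiffAt_ext (c : Cover E) (hE : IsCompact E) (hne : E.Nonempty) (f : X → F) (d : X → X →L[ℝ] F)
    {x : X} (hx : x ∉ E) {n : ℕ∞} : ContDiffAt ℝ n (c.ext hE hne f d) x := by
  have hrx : 0 < rad E x := rad_pos hE.isClosed hne hx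
  have hev : c.ext hE hne f d =ᶠ[𝓝 x] fun y => ∑ b ∈ c.nearF x hrx, c.v b y • germ f d (npt hE hne b) y := by
    have hopen : IsOpen ({y : X | ‖y - x‖ < 10 * rad E x} ∩ Eᶜ) :=
      (isOpen_lt (continuous_id.sub continuous_const).norm continuous_const).inter hE.isClosed.isOpen_compl
    exact Filter.eventuallyEq_of_mem (hopen.mem_nhds ⟨by simp [hrx], hx⟩) fun y hy => c.ext_eq_sum hE hne f d hrx hy.1 hy.2
  refine ContDiffAt.congr_of_eventuallyEq ?_ hev
  refine ContDiffAt.sum fun b hb => ?_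
  have hbu : b ∈ c.u := ((c.mem_nearF_iff hrx).mp hb).1
  refine ContDiffAt.smul ?_ ?_
  · -- `v_b = bump / σ` is smooth near `x`
    have hfun : c.v b = fun y => bump b (rad E b) y / c.sigma y := by funext y; exact c.v_eq hbu y
    rw [hfun]
    exact (contDiff_bump b (rad E b)).contDiffAt.div (c.contDiffAt_sigma hE.isClosed hne hx)
      (by linarith [c.one_le_sigma hE.isClosed hne hx])
  · unfold germ
    exact (contDiffAt_const.add ((d (npt hE hne b)).contDiff.contDiffAt.comp x
      (contDiffAt_id.sub contDiffAt_const)))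

/-- **The derivative of `f̄` off `E`.** [cite: EvansGariepy2015, §6.5 Thm. 6.10, step 4] -/
theorem Cover.hasFDerivAt_ext (c : Cover E) (hE : IsCompact E) (hne : E.Nonempty) (f : X → F) (d : X → X →L[ℝ] F)
    {x : X} (hx : x ∉ E) :
    HasFDerivAt (c.ext hE hne f d) (∑ b ∈ c.nearF x (rad_pos hE.isClosed hne hx),
      (c.v b x • d (npt hE hne b) + (c.Dv b x).smulRight (germ f d (npt hE hne b) x))) x := by
  have hrx : 0 < rad E x := rad_pos hE.isClosed hne hx
  have hev : c.ext hE hne f d =ᶠ[𝓝 x] fun y => ∑ b ∈ c.nearF x hrx, c.v b y • germ f d (npt hE hne b) y := by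
    have hopen : IsOpen ({y : X | ‖y - x‖ < 10 * rad E x} ∩ Eᶜ) :=
      (isOpen_lt (continuous_id.sub continuous_const).norm continuous_const).inter hE.isClosed.isOpen_compl
    exact Filter.eventuallyEq_of_mem (hopen.mem_nhds ⟨by simp [hrx], hx⟩) fun y hy => c.ext_eq_sum hE hne f d hrx hy.1 hy.2
  refine HasFDerivAt.congr_of_eventuallyEq ?_ hev
  refine HasFDerivAt.fun_sum fun b hb => ?_
  have hbu : b ∈ c.u := ((c.mem_nearF_iff hrx).mp hb).1
  have hgerm : HasFDerivAt (germ f d (npt hE hne b)) (d (npt hE hne b)) x := by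
    have h1 : HasFDerivAt (fun y : X => y - npt hE hne b) (ContinuousLinearMap.id ℝ X) x :=
      (hasFDerivAt_id x).sub_const (npt hE hne b)
    have h2 := ((d (npt hE hne b)).hasFDerivAt.comp x h1).const_add (f (npt hE hne b))
    rw [ContinuousLinearMap.comp_id] at h2
    exact h2
  exact (c.hasFDerivAt_v hE.isClosed hne hbu hx).smul hgerm


/-! ## Geometry near `E` -/

omit [InnerProductSpace ℝ X] [FiniteDimensional ℝ X] in
/-- `20 r(y) ≤ dist(y, E) = ‖y - npt y‖`. [cite: EvansGariepy2015, §6.5 Thm. 6.10, step 5] -/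
theorem norm_sub_npt (hE : IsCompact E) (hne : E.Nonempty) (y : X) : ‖y - npt hE hne y‖ = infDist y E := by
  rw [(npt_spec hE hne y).2, dist_eq_norm]

omit [InnerProductSpace ℝ X] [FiniteDimensional ℝ X] in
/-- **Distances for centres near `y`** (`b ∈ S_y`, `D = dist(y, E)`): `‖b - y‖ ≤ 2D`,
`‖s_b - b₀‖ ≤ 6D`, `‖y - s_b‖ ≤ 5D` where `s_b, b₀` are the nearest points of `b, y`.
[cite: EvansGariepy2015, §6.5 Thm. 6.10, steps 5–6] -/
theorem Cover.dist_bounds (c : Cover E) (hE : IsCompact E) (hne : E.Nonempty) {y b : X} (hb : b ∈ c.near y) :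
    ‖b - y‖ ≤ 2 * infDist y E ∧ ‖npt hE hne b - npt hE hne y‖ ≤ 6 * infDist y E ∧
      ‖y - npt hE hne b‖ ≤ 5 * infDist y E := by
  have hD := twenty_mul_rad_le_infDist E y
  have hrb := (c.rad_le_of_mem_near hb).2
  have h1 : ‖b - y‖ ≤ 2 * infDist y E := by
    have := hb.2
    rw [norm_sub_rev] at this
    linarith
  have hy0 := norm_sub_npt hE hne y
  have hb0 : ‖b - npt hE hne b‖ ≤ 3 * infDist y E := by
    rw [norm_sub_npt hE hne b]
    calc infDist b E ≤ dist b (npt hE hne y) := infDist_le_dist_of_mem (npt_spec hE hne y).1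
      _ = ‖(b - y) + (y - npt hE hne y)‖ := by rw [dist_eq_norm, sub_add_sub_cancel]
      _ ≤ ‖b - y‖ + ‖y - npt hE hne y‖ := norm_add_le _ _
      _ ≤ 2 * infDist y E + infDist y E := by rw [hy0]; linarith
      _ = 3 * infDist y E := by ring
  refine ⟨h1, ?_, ?_⟩
  · calc ‖npt hE hne b - npt hE hne y‖ = ‖(npt hE hne b - b) + (b - y) + (y - npt hE hne y)‖ := by
          congr 1; abel
      _ ≤ ‖npt hE hne b - b‖ + ‖b - y‖ + ‖y - npt hE hne y‖ := norm_add₃_le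
      _ ≤ 3 * infDist y E + 2 * infDist y E + infDist y E := by
          rw [norm_sub_rev, hy0]; linarith
      _ = 6 * infDist y E := by ring
  · calc ‖y - npt hE hne b‖ = ‖(y - b) + (b - npt hE hne b)‖ := by rw [sub_add_sub_cancel]
      _ ≤ ‖y - b‖ + ‖b - npt hE hne b‖ := norm_add_le _ _
      _ ≤ 2 * infDist y E + 3 * infDist y E := by rw [norm_sub_rev]; linarith
      _ = 5 * infDist y E := by ring

omit [InnerProductSpace ℝ X] [FiniteDimensional ℝ X] in
/-- `dist(y, E) ≤ ‖y - a‖` for `a ∈ E`, and `‖npt y - a‖ ≤ 2 ‖y - a‖`. [cite: EvansGariepy2015, §6.5 Thm. 6.10, step 6] -/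
theorem infDist_le_and_npt (hE : IsCompact E) (hne : E.Nonempty) {a : X} (ha : a ∈ E) (y : X) :
    infDist y E ≤ ‖y - a‖ ∧ ‖npt hE hne y - a‖ ≤ 2 * ‖y - a‖ := by
  have h1 : infDist y E ≤ ‖y - a‖ := by rw [← dist_eq_norm]; exact infDist_le_dist_of_mem ha
  refine ⟨h1, ?_⟩
  calc ‖npt hE hne y - a‖ = ‖(npt hE hne y - y) + (y - a)‖ := by rw [sub_add_sub_cancel]
    _ ≤ ‖npt hE hne y - y‖ + ‖y - a‖ := norm_add_le _ _
    _ ≤ ‖y - a‖ + ‖y - a‖ := by rw [norm_sub_rev, norm_sub_npt]; linarith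
    _ = 2 * ‖y - a‖ := by ring

omit [FiniteDimensional ℝ X] in
/-- The algebra of the remainder: `A_b(y) - f(a) - d(a)(y - a)
= [f(s_b) - f(a) - d(a)(s_b - a)] + (d(s_b) - d(a))(y - s_b)`. [cite: EvansGariepy2015, §6.5 Thm. 6.10, step 5] -/
theorem germ_sub_eq (f : X → F) (d : X → X →L[ℝ] F) (s a y : X) :
    germ f d s y - f a - d a (y - a) = (f s - f a - d a (s - a)) + (d s - d a) (y - s) := by
  simp only [germ, map_sub, FunLike.coe_sub, Pi.sub_apply]
  abel

/-! ## Claim 2: differentiability at the points of `E` -/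

/-- **Claim 2**: `f̄` is differentiable at every `a ∈ E` with `Df̄(a) = d(a)`.
[cite: EvansGariepy2015, §6.5 Thm. 6.10, Claim 2] -/
theorem Cover.hasFDerivAt_ext_of_mem (c : Cover E) (hE : IsCompact E) (hne : E.Nonempty) {f : X → F}
    {d : X → X →L[ℝ] F}
    (hd : ∀ ε > 0, ∃ δ > 0, ∀ p ∈ E, ∀ q ∈ E, ‖p - q‖ < δ → ‖d p - d q‖ ≤ ε)
    (hR : ∀ ε > 0, ∃ δ > 0, ∀ p ∈ E, ∀ q ∈ E, ‖p - q‖ < δ → ‖f p - f q - d q (p - q)‖ ≤ ε * ‖p - q‖)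
    {a : X} (ha : a ∈ E) : HasFDerivAt (c.ext hE hne f d) (d a) a := by
  rw [hasFDerivAt_iff_isLittleO, Asymptotics.isLittleO_iff]
  intro ε hε
  obtain ⟨δ₁, hδ₁, hR'⟩ := hR (ε / 13) (by positivity)
  obtain ⟨δ₂, hδ₂, hd'⟩ := hd (ε / 13) (by positivity)
  have hball : ball a (min δ₁ δ₂ / 8) ∈ 𝓝 a := ball_mem_nhds a (by positivity)
  refine Filter.mem_of_superset hball fun y hy => ?_
  rw [mem_ball, dist_eq_norm] at hy
  have hy1 : 8 * ‖y - a‖ < δ₁ := by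
    have := min_le_left δ₁ δ₂; linarith
  have hy2 : 8 * ‖y - a‖ < δ₂ := by
    have := min_le_right δ₁ δ₂; linarith
  show ‖c.ext hE hne f d y - c.ext hE hne f d a - d a (y - a)‖ ≤ ε * ‖y - a‖
  rw [c.ext_of_mem hE hne f d ha]
  by_cases hyE : y ∈ E
  · rw [c.ext_of_mem hE hne f d hyE]
    calc ‖f y - f a - d a (y - a)‖ ≤ ε / 13 * ‖y - a‖ := hR' y hyE a ha (by linarith [norm_nonneg (y - a)])
      _ ≤ ε * ‖y - a‖ := by gcongr; linarith
  · have hry : 0 < rad E y := rad_pos hE.isClosed hne hyE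
    have hrep := c.ext_eq_sum hE hne f d hry (by simp [hry] : ‖y - y‖ < 10 * rad E y) hyE
    have hsum1 := c.sum_v_eq_one hE.isClosed hne hyE (by simp [hry] : ‖y - y‖ < 10 * rad E y) hyE
    -- rewrite the remainder as a convex combination
    have hcomb : c.ext hE hne f d y - f a - d a (y - a) =
        ∑ b ∈ c.nearF y hry, c.v b y • (germ f d (npt hE hne b) y - f a - d a (y - a)) := by
      rw [hrep]
      simp only [smul_sub, Finset.sum_sub_distrib, ← Finset.sum_smul, hsum1, one_smul]
    rw [hcomb]
    obtain ⟨hDy, -⟩ := infDist_le_and_npt hE hne ha y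
    have hterm : ∀ b ∈ c.nearF y hry, ‖c.v b y • (germ f d (npt hE hne b) y - f a - d a (y - a))‖ ≤
        c.v b y * (ε * ‖y - a‖) := by
      intro b hb
      have hbn := (c.mem_nearF_iff hry).mp hb
      obtain ⟨-, h6, h5⟩ := c.dist_bounds hE hne hbn
      obtain ⟨-, h2⟩ := infDist_le_and_npt hE hne ha y
      have hv := c.v_mem_Icc hE.isClosed hne b hyE
      set sb := npt hE hne b
      have hsb : sb ∈ E := (npt_spec hE hne b).1
      have hsa : ‖sb - a‖ ≤ 8 * ‖y - a‖ := by
        calc ‖sb - a‖ = ‖(sb - npt hE hne y) + (npt hE hne y - a)‖ := by rw [sub_add_sub_cancel]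
          _ ≤ ‖sb - npt hE hne y‖ + ‖npt hE hne y - a‖ := norm_add_le _ _
          _ ≤ 6 * infDist y E + 2 * ‖y - a‖ := add_le_add h6 h2
          _ ≤ 8 * ‖y - a‖ := by linarith
      have hys : ‖y - sb‖ ≤ 5 * ‖y - a‖ := h5.trans (by linarith)
      rw [norm_smul, Real.norm_of_nonneg hv.1]
      refine mul_le_mul_of_nonneg_left ?_ hv.1
      rw [germ_sub_eq]
      calc ‖f sb - f a - d a (sb - a) + (d sb - d a) (y - sb)‖
          ≤ ‖f sb - f a - d a (sb - a)‖ + ‖(d sb - d a) (y - sb)‖ := norm_add_le _ _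
        _ ≤ ε / 13 * ‖sb - a‖ + ‖d sb - d a‖ * ‖y - sb‖ := by
            gcongr
            · exact hR' sb hsb a ha (by linarith)
            · exact ContinuousLinearMap.le_opNorm _ _
        _ ≤ ε / 13 * (8 * ‖y - a‖) + ε / 13 * (5 * ‖y - a‖) := by
            gcongr
            · exact hd' sb hsb a ha (by linarith)
        _ = ε * ‖y - a‖ := by ring
    calc ‖∑ b ∈ c.nearF y hry, c.v b y • (germ f d (npt hE hne b) y - f a - d a (y - a))‖
        ≤ ∑ b ∈ c.nearF y hry, ‖c.v b y • (germ f d (npt hE hne b) y - f a - d a (y - a))‖ := norm_sum_le _ _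
      _ ≤ ∑ b ∈ c.nearF y hry, c.v b y * (ε * ‖y - a‖) := Finset.sum_le_sum hterm
      _ = ε * ‖y - a‖ := by rw [← Finset.sum_mul, hsum1, one_mul]

/-! ## Claim 3: continuity of the derivative at the points of `E` -/

/-- **The derivative estimate off `E`** (`(⋆⋆⋆⋆)` of loc. cit.): for `y ∉ E` with
`dist(y, E) ≤ 1`, `‖Df̄(y) - d(b₀)‖ ≤ ε₂ + 129ⁿ · 20 C₃ (6 ε₁ + 5 ε₂)` whenever the remainder and
the oscillation of `d` are `≤ ε₁, ε₂` at scale `6 dist(y, E)` around `b₀ = npt y`.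
[cite: EvansGariepy2015, §6.5 Thm. 6.10, Claim 3] -/
theorem Cover.norm_fderiv_ext_sub_le (c : Cover E) (hE : IsCompact E) (hne : E.Nonempty) {f : X → F}
    {d : X → X →L[ℝ] F} {C : ℝ} (hC : ∀ t, ‖deriv wcut t‖ ≤ C) {y : X} (hyE : y ∉ E) (hy1 : infDist y E ≤ 1)
    {ε₁ ε₂ : ℝ} (hε₁ : 0 ≤ ε₁) (hε₂ : 0 ≤ ε₂)
    (hR : ∀ p ∈ E, ‖p - npt hE hne y‖ ≤ 6 * infDist y E →
      ‖f p - f (npt hE hne y) - d (npt hE hne y) (p - npt hE hne y)‖ ≤ ε₁ * ‖p - npt hE hne y‖)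
    (hd : ∀ p ∈ E, ‖p - npt hE hne y‖ ≤ 6 * infDist y E → ‖d p - d (npt hE hne y)‖ ≤ ε₂) :
    ‖fderiv ℝ (c.ext hE hne f d) y - d (npt hE hne y)‖ ≤
      ε₂ + 129 ^ finrank ℝ X * (20 * (3 * C * (1 + 129 ^ finrank ℝ X)) * (6 * ε₁ + 5 * ε₂)) := by
  have hry : 0 < rad E y := rad_pos hE.isClosed hne hyE
  have hC0 : 0 ≤ C := (norm_nonneg _).trans (hC 0)
  set b₀ := npt hE hne y with hb₀
  set C₃ := 3 * C * (1 + 129 ^ finrank ℝ X) with hC₃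
  set D := infDist y E with hDdef
  have hD20 : D = 20 * rad E y := (twenty_mul_rad_eq hy1).symm
  rw [(c.hasFDerivAt_ext hE hne f d hyE).fderiv]
  have hsum1 := c.sum_v_eq_one hE.isClosed hne hyE (by simp [hry] : ‖y - y‖ < 10 * rad E y) hyE
  have hsum0 := c.sum_Dv_eq_zero hE.isClosed hne hyE
  set V : X → F := fun b => germ f d (npt hE hne b) y - f b₀ - d b₀ (y - b₀) with hV
  -- pointwise algebra: `(L - d b₀) h = Σ_b [v_b • (d s_b - d b₀) h + (Dv_b h) • V_b]`
  have hpt : ∀ h : X, (∑ b ∈ c.nearF y hry, (c.v b y • d (npt hE hne b) +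
      (c.Dv b y).smulRight (germ f d (npt hE hne b) y)) - d b₀) h =
      ∑ b ∈ c.nearF y hry, (c.v b y • (d (npt hE hne b) - d b₀) h + (c.Dv b y h) • V b) := by
    intro h
    have hv1 : ∑ b ∈ c.nearF y hry, c.v b y • d b₀ h = d b₀ h := by
      rw [← Finset.sum_smul, hsum1, one_smul]
    have hD0 : ∀ w : F, ∑ b ∈ c.nearF y hry, (c.Dv b y h) • w = 0 := by
      intro w
      rw [← Finset.sum_smul]
      have : ∑ b ∈ c.nearF y hry, c.Dv b y h = (∑ b ∈ c.nearF y hry, c.Dv b y) h := by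
        simp
      rw [this, hsum0, zero_apply, zero_smul]
    have hrhs : ∑ b ∈ c.nearF y hry, (c.v b y • (d (npt hE hne b) - d b₀) h + (c.Dv b y h) • V b) =
        ∑ b ∈ c.nearF y hry, (c.v b y • d (npt hE hne b) h + (c.Dv b y h) • germ f d (npt hE hne b) y)
          - ∑ b ∈ c.nearF y hry, c.v b y • d b₀ h
          - ∑ b ∈ c.nearF y hry, (c.Dv b y h) • (f b₀ + d b₀ (y - b₀)) := by
      rw [← Finset.sum_sub_distrib, ← Finset.sum_sub_distrib]
      refine Finset.sum_congr rfl fun b _ => ?_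
      simp only [hV, FunLike.coe_sub, Pi.sub_apply, smul_sub, smul_add]
      abel
    rw [hrhs, hv1, hD0, sub_zero]
    simp
  -- termwise bounds
  have hterm : ∀ b ∈ c.nearF y hry, ∀ h : X,
      ‖c.v b y • (d (npt hE hne b) - d b₀) h + (c.Dv b y h) • V b‖ ≤
        (c.v b y * ε₂ + 20 * C₃ * (6 * ε₁ + 5 * ε₂)) * ‖h‖ := by
    intro b hb h
    have hbn := (c.mem_nearF_iff hry).mp hb
    obtain ⟨-, h6, h5⟩ := c.dist_bounds hE hne hbn
    have hv := c.v_mem_Icc hE.isClosed hne b hyE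
    have hsb : npt hE hne b ∈ E := (npt_spec hE hne b).1
    have hDv : ‖c.Dv b y‖ ≤ C₃ / rad E y := c.norm_Dv_le hE.isClosed hne hC hyE hbn
    have hVb : ‖V b‖ ≤ (6 * ε₁ + 5 * ε₂) * D := by
      simp only [hV]
      rw [germ_sub_eq]
      calc ‖f (npt hE hne b) - f b₀ - d b₀ (npt hE hne b - b₀) + (d (npt hE hne b) - d b₀) (y - npt hE hne b)‖
          ≤ ‖f (npt hE hne b) - f b₀ - d b₀ (npt hE hne b - b₀)‖ + ‖(d (npt hE hne b) - d b₀) (y - npt hE hne b)‖ :=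
            norm_add_le _ _
        _ ≤ ε₁ * ‖npt hE hne b - b₀‖ + ‖d (npt hE hne b) - d b₀‖ * ‖y - npt hE hne b‖ := by
            gcongr
            · exact hR _ hsb h6
            · exact ContinuousLinearMap.le_opNorm _ _
        _ ≤ ε₁ * (6 * D) + ε₂ * (5 * D) := by
            gcongr
            · exact hd _ hsb h6
        _ = (6 * ε₁ + 5 * ε₂) * D := by ring
    have hC₃0 : 0 ≤ C₃ := by rw [hC₃]; positivity
    calc ‖c.v b y • (d (npt hE hne b) - d b₀) h + (c.Dv b y h) • V b‖
        ≤ ‖c.v b y • (d (npt hE hne b) - d b₀) h‖ + ‖(c.Dv b y h) • V b‖ := norm_add_le _ _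
      _ ≤ c.v b y * (ε₂ * ‖h‖) + (C₃ / rad E y * ‖h‖) * ((6 * ε₁ + 5 * ε₂) * D) := by
          gcongr
          · rw [norm_smul, Real.norm_of_nonneg hv.1]
            refine mul_le_mul_of_nonneg_left ?_ hv.1
            exact (ContinuousLinearMap.le_opNorm _ _).trans (mul_le_mul_of_nonneg_right (hd _ hsb h6) (norm_nonneg _))
          · rw [norm_smul]
            gcongr
            · exact (ContinuousLinearMap.le_opNorm _ _).trans (mul_le_mul_of_nonneg_right hDv (norm_nonneg _))
      _ = (c.v b y * ε₂ + 20 * C₃ * (6 * ε₁ + 5 * ε₂)) * ‖h‖ := by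
          rw [hD20]; field_simp
  -- assemble with the operator norm
  refine ContinuousLinearMap.opNorm_le_bound _ (by positivity) fun h => ?_
  rw [hpt h]
  calc ‖∑ b ∈ c.nearF y hry, (c.v b y • (d (npt hE hne b) - d b₀) h + (c.Dv b y h) • V b)‖
      ≤ ∑ b ∈ c.nearF y hry, ‖c.v b y • (d (npt hE hne b) - d b₀) h + (c.Dv b y h) • V b‖ := norm_sum_le _ _
    _ ≤ ∑ b ∈ c.nearF y hry, (c.v b y * ε₂ + 20 * C₃ * (6 * ε₁ + 5 * ε₂)) * ‖h‖ :=
        Finset.sum_le_sum fun b hb => hterm b hb h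
    _ = (ε₂ * ∑ b ∈ c.nearF y hry, c.v b y + (c.nearF y hry).card * (20 * C₃ * (6 * ε₁ + 5 * ε₂))) * ‖h‖ := by
        rw [← Finset.sum_mul, Finset.sum_add_distrib, Finset.sum_const, nsmul_eq_mul, Finset.mul_sum]
        congr 1; congr 1
        exact Finset.sum_congr rfl fun b _ => mul_comm _ _
    _ ≤ (ε₂ + 129 ^ finrank ℝ X * (20 * C₃ * (6 * ε₁ + 5 * ε₂))) * ‖h‖ := by
        rw [hsum1, mul_one]
        have hC₃0 : 0 ≤ C₃ := by rw [hC₃]; positivity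
        gcongr
        exact c.card_nearF_le hry


/-! ## The theorem -/

/-- **Whitney's extension theorem (`C¹` case)** [EvansGariepy2015, Thm. 6.10], for a compact
set `E` in a finite-dimensional real inner product space and Banach-space-valued data: if
`d` is continuous on `E` and the remainder `f p - f q - d q (p - q)` is uniformly `o(‖p - q‖)`
on `E`, then some `C¹` map `g` on the whole space has `g = f` and `Dg = d` on `E`.
[cite: EvansGariepy2015, §6.5 Thm. 6.10] -/
theorem whitney_extension_C1 (hE : IsCompact E) (f : X → F) (d : X → X →L[ℝ] F) (hd : ContinuousOn d E)
    (hR : ∀ ε > 0, ∃ δ > 0, ∀ p ∈ E, ∀ q ∈ E, ‖p - q‖ < δ → ‖f p - f q - d q (p - q)‖ ≤ ε * ‖p - q‖) :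
    ∃ g : X → F, ContDiff ℝ 1 g ∧ (∀ x ∈ E, g x = f x) ∧ ∀ x ∈ E, HasFDerivAt g (d x) x := by
  rcases E.eq_empty_or_nonempty with hEe | hne
  · subst hEe
    exact ⟨fun _ => 0, contDiff_const, fun x hx => absurd hx (notMem_empty x), fun x hx => absurd hx (notMem_empty x)⟩
  obtain ⟨c⟩ := exists_cover hE.isClosed hne
  obtain ⟨C, hCpos, hC⟩ := exists_bound_deriv_wcut
  -- uniform continuity of `d` on `E`
  have hd' : ∀ ε > 0, ∃ δ > 0, ∀ p ∈ E, ∀ q ∈ E, ‖p - q‖ < δ → ‖d p - d q‖ ≤ ε := by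
    intro ε hε
    obtain ⟨δ, hδ, h⟩ := Metric.uniformContinuousOn_iff.mp (hE.uniformContinuousOn_of_continuous hd) ε hε
    refine ⟨δ, hδ, fun p hp q hq hpq => ?_⟩
    rw [← dist_eq_norm] at hpq ⊢
    exact (h p hp q hq hpq).le
  set g := c.ext hE hne f d with hg
  have hderE : ∀ a ∈ E, HasFDerivAt g (d a) a := fun a ha => c.hasFDerivAt_ext_of_mem hE hne hd' hR ha
  have hdiff : Differentiable ℝ g := fun x => by
    by_cases hx : x ∈ E
    · exact (hderE x hx).differentiableAt
    · exact (c.contDiffAt_ext hE hne f d hx (n := ⊤)).differentiableAt (by simp)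
  refine ⟨g, ?_, fun x hx => c.ext_of_mem hE hne f d hx, hderE⟩
  rw [contDiff_one_iff_fderiv]
  refine ⟨hdiff, continuous_iff_continuousAt.mpr fun a => ?_⟩
  by_cases ha : a ∈ E
  swap
  · exact (c.contDiffAt_ext hE hne f d ha (n := ⊤)).continuousAt_fderiv (by simp)
  -- Claim 3 at `a ∈ E`
  rw [Metric.continuousAt_iff]
  intro ε hε
  set K : ℝ := 129 ^ finrank ℝ X * (20 * (3 * C * (1 + 129 ^ finrank ℝ X))) with hK
  have hK0 : 0 ≤ K := by rw [hK]; positivity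
  set η : ℝ := ε / (6 + 22 * K) with hη
  have hηpos : 0 < η := by rw [hη]; positivity
  obtain ⟨δ₁, hδ₁, hR₁⟩ := hR η hηpos
  obtain ⟨δ₂, hδ₂, hd₂⟩ := hd' η hηpos
  refine ⟨min (min (δ₁ / 6) (δ₂ / 6)) 1, by positivity, fun y hy => ?_⟩
  rw [dist_eq_norm] at hy
  have hm1 : min (min (δ₁ / 6) (δ₂ / 6)) 1 ≤ δ₁ / 6 := (min_le_left _ _).trans (min_le_left _ _)
  have hm2 : min (min (δ₁ / 6) (δ₂ / 6)) 1 ≤ δ₂ / 6 := (min_le_left _ _).trans (min_le_right _ _)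
  have hy1 : 6 * ‖y - a‖ < δ₁ := by linarith [lt_of_lt_of_le hy hm1]
  have hy2 : 6 * ‖y - a‖ < δ₂ := by linarith [lt_of_lt_of_le hy hm2]
  have hy3 : ‖y - a‖ < 1 := lt_of_lt_of_le hy (min_le_right _ _)
  rw [dist_eq_norm, (hderE a ha).fderiv]
  by_cases hyE : y ∈ E
  · rw [(hderE y hyE).fderiv]
    calc ‖d y - d a‖ ≤ η := hd₂ y hyE a ha (by linarith [norm_nonneg (y - a)])
      _ < ε := by
        rw [hη, div_lt_iff₀ (by positivity)]
        nlinarith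
  · obtain ⟨hD, hb0a⟩ := infDist_le_and_npt hE hne ha y
    have hest := c.norm_fderiv_ext_sub_le hE hne hC hyE (by linarith) hηpos.le hηpos.le
      (fun p hp hpb => hR₁ p hp _ (npt_spec hE hne y).1 (by linarith))
      (fun p hp hpb => hd₂ p hp _ (npt_spec hE hne y).1 (by linarith))
    have hb0 : ‖d (npt hE hne y) - d a‖ ≤ η := hd₂ _ (npt_spec hE hne y).1 a ha (by linarith)
    calc ‖fderiv ℝ g y - d a‖ = ‖(fderiv ℝ g y - d (npt hE hne y)) + (d (npt hE hne y) - d a)‖ := by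
          rw [sub_add_sub_cancel]
      _ ≤ ‖fderiv ℝ g y - d (npt hE hne y)‖ + ‖d (npt hE hne y) - d a‖ := norm_add_le _ _
      _ ≤ (η + K * (6 * η + 5 * η)) + η := by
          refine add_le_add (hest.trans_eq ?_) hb0
          rw [hK]; ring
      _ = η * (2 + 11 * K) := by ring
      _ < ε := by
        rw [hη, div_mul_eq_mul_div, div_lt_iff₀ (by positivity)]
        nlinarith

/-- **Whitney's extension theorem, `fderiv` form.** [cite: EvansGariepy2015, §6.5 Thm. 6.10] -/
theorem whitney_extension_C1' (hE : IsCompact E) (f : X → F) (d : X → X →L[ℝ] F) (hd : ContinuousOn d E)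
    (hR : ∀ ε > 0, ∃ δ > 0, ∀ p ∈ E, ∀ q ∈ E, ‖p - q‖ < δ → ‖f p - f q - d q (p - q)‖ ≤ ε * ‖p - q‖) :
    ∃ g : X → F, ContDiff ℝ 1 g ∧ (∀ x ∈ E, g x = f x) ∧ ∀ x ∈ E, fderiv ℝ g x = d x := by
  obtain ⟨g, hg, hgf, hgd⟩ := whitney_extension_C1 hE f d hd hR
  exact ⟨g, hg, hgf, fun x hx => (hgd x hx).fderiv⟩

end Extension

/-! ## Finite-dimensional normed spaces -/

section FiniteDimensional

open Module

variable {V : Type*} [NormedAddCommGroup V] [NormedSpace ℝ V] [FiniteDimensional ℝ V]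
  {F : Type*} [NormedAddCommGroup F] [NormedSpace ℝ F]

/-- **Whitney's `C¹` extension theorem in a finite-dimensional real normed space** (any norm;
transferred from the Euclidean case through `toEuclidean`). [cite: EvansGariepy2015, §6.5 Thm. 6.10] -/
theorem whitney_extension_C1_of_finiteDimensional {E : Set V} (hE : IsCompact E) (f : V → F)
    (d : V → V →L[ℝ] F) (hd : ContinuousOn d E)
    (hR : ∀ ε > 0, ∃ δ > 0, ∀ p ∈ E, ∀ q ∈ E, ‖p - q‖ < δ → ‖f p - f q - d q (p - q)‖ ≤ ε * ‖p - q‖) :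
    ∃ g : V → F, ContDiff ℝ 1 g ∧ (∀ x ∈ E, g x = f x) ∧ ∀ x ∈ E, HasFDerivAt g (d x) x := by
  -- transfer to the Euclidean model
  set φ : EuclideanSpace ℝ (Fin (finrank ℝ V)) ≃L[ℝ] V := toEuclidean.symm with hφ
  set E' : Set (EuclideanSpace ℝ (Fin (finrank ℝ V))) := φ ⁻¹' E with hE'
  have hE'c : IsCompact E' := by
    rw [hE', ← φ.image_symm_eq_preimage]
    exact hE.image φ.symm.continuous
  set f' : EuclideanSpace ℝ (Fin (finrank ℝ V)) → F := f ∘ φ with hf'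
  set d' : EuclideanSpace ℝ (Fin (finrank ℝ V)) → EuclideanSpace ℝ (Fin (finrank ℝ V)) →L[ℝ] F :=
    fun x' => (d (φ x')).comp (φ : EuclideanSpace ℝ (Fin (finrank ℝ V)) →L[ℝ] V) with hd'
  have hdc' : ContinuousOn d' E' := by
    have h1 : ContinuousOn (fun x' => d (φ x')) E' := hd.comp φ.continuous.continuousOn fun x hx => hx
    exact ((ContinuousLinearMap.compL ℝ (EuclideanSpace ℝ (Fin (finrank ℝ V))) V F).flip
      (φ : EuclideanSpace ℝ (Fin (finrank ℝ V)) →L[ℝ] V)).continuous.comp_continuousOn h1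
  set M : ℝ := max ‖(φ : EuclideanSpace ℝ (Fin (finrank ℝ V)) →L[ℝ] V)‖ 1 with hM
  have hM1 : 1 ≤ M := le_max_right _ _
  have hMφ : ‖(φ : EuclideanSpace ℝ (Fin (finrank ℝ V)) →L[ℝ] V)‖ ≤ M := le_max_left _ _
  have hR' : ∀ ε > 0, ∃ δ > 0, ∀ p ∈ E', ∀ q ∈ E', ‖p - q‖ < δ → ‖f' p - f' q - d' q (p - q)‖ ≤ ε * ‖p - q‖ := by
    intro ε hε
    obtain ⟨δ, hδ, h⟩ := hR (ε / M) (by positivity)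
    refine ⟨δ / M, by positivity, fun p hp q hq hpq => ?_⟩
    have hnorm : ‖φ p - φ q‖ ≤ M * ‖p - q‖ := by
      rw [← map_sub]
      exact ((φ : EuclideanSpace ℝ (Fin (finrank ℝ V)) →L[ℝ] V).le_opNorm _).trans
        (mul_le_mul_of_nonneg_right hMφ (norm_nonneg _))
    have hlt : ‖φ p - φ q‖ < δ := by
      calc ‖φ p - φ q‖ ≤ M * ‖p - q‖ := hnorm
        _ < M * (δ / M) := by gcongr
        _ = δ := by field_simp
    have := h (φ p) hp (φ q) hq hlt
    simp only [hf', hd', Function.comp_apply, ContinuousLinearMap.comp_apply, ContinuousLinearEquiv.coe_coe,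
      map_sub]
    calc ‖f (φ p) - f (φ q) - (d (φ q) (φ p) - d (φ q) (φ q))‖ = ‖f (φ p) - f (φ q) - d (φ q) (φ p - φ q)‖ := by
          rw [map_sub]
      _ ≤ ε / M * ‖φ p - φ q‖ := this
      _ ≤ ε / M * (M * ‖p - q‖) := by gcongr
      _ = ε * ‖p - q‖ := by field_simp
  obtain ⟨g', hg', hgf', hgd'⟩ := whitney_extension_C1 hE'c f' d' hdc' hR'
  refine ⟨g' ∘ φ.symm, hg'.comp φ.symm.contDiff, fun x hx => ?_, fun x hx => ?_⟩
  · have hx' : φ.symm x ∈ E' := by simp [hE', hx]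
    simp [hgf' _ hx', hf']
  · have hx' : φ.symm x ∈ E' := by simp [hE', hx]
    have h1 := (hgd' _ hx').comp x φ.symm.hasFDerivAt
    have heq : (d' (φ.symm x)).comp (φ.symm : V →L[ℝ] EuclideanSpace ℝ (Fin (finrank ℝ V))) = d x := by
      ext v
      simp [hd']
    rw [heq] at h1
    exact h1

end FiniteDimensional


end Whitney

end Literature.Analysis.Calculus
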